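import Mathlib
import Summits.ValiantsHypothesis.ValiantsHypothesis.Theses.ValuativeGCT
import Summits.ValiantsHypothesis.ValiantsHypothesis.Theorems.ValuativeGCTValuativeFlipStabInvLeExplicit
import Summits.ValiantsHypothesis.ValiantsHypothesis.Theorems.ValuativeGCTValuativeFlipSliceBound
import Summits.ValiantsHypothesis.ValiantsHypothesis.Theorems.ValuativeGCTValuativeFlipTangentRank
import Summits.ValiantsHypothesis.ValiantsHypothesis.Theorems.ValuativeGCTValuativeFlipHilbertLowerBound
import Summits.ValiantsHypothesis.ValiantsHypothesis.Theorems.ValuativeGCTValuativeFlipMultiplicityCount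
import Summits.ValiantsHypothesis.ValiantsHypothesis.Theorems.ValuativeGCTValuativeFlipGrowthGap
import Summits.ValiantsHypothesis.ValiantsHypothesis.Theorems.ValuativeGCTValuativeFlipBottomBridge

/-!
# `ValuativeFlip` at the bottom of every window (`m = n ≥ 3`)

Line `skew-restriction-rank` for crux `ValuativeGCT.ValuativeFlip` (stmt-ValiantsHypothesis-12624,
route-ValiantsHypothesis-ValuativeGCT), second line lead, 2026-08-16.  This file composes the six landed
bottom-of-the-window stubs (B1 `stub_sliceBound`, B2 `stub_tangentRank`, B3 `stub_hilbertLowerBound`,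
B4 `stub_multiplicityCount`, B5 `stub_growthGap`, B6 `stub_bottomBridge`) and stub 1 (`stub_stabInv_le_explicit`)
into two theorems:

* `bottomCensusFlip` — E-currency: for `n ≥ 3` there are `δ` and `λ ⊢ nδ` (`≤ n²` parts) with
  `dim (Hom_{nδ}(ℂ[End W]) ∩ sandInv ∩ trInv ∩ HWV_{λ*}) < mult_{λ*} ℂ[Δ_n(per_n)]` — the explicit det-side
  census space is beaten by the permanent's orbit-closure multiplicity;
* `valuativeFlip_bottom` — crux currency: the body of `ValuativeGCT.ValuativeFlip` (route file, verbatim,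
  `m := n`) holds at `m = n` for every `n ≥ 3`, with the no-cut centre `U = ⊥`, `r = 0`.

Mechanism (Hilbert-function count, cdisprove's "F2 square case", made formal): the det side restricts
injectively to a Krylov/companion slice of dimension `z = n⁴-2n²+2n`, so `dim ≤ (nδ+1)^z` (B1); the per side
contains `C(δ+N, N)` independent products, `N+1 = n⁴-n² ≤ dim span{x_a ∂_b per_n}` (B2, B3: initial forms at
`A = 1`); `z+1 ≤ N` for `n ≥ 3`, so some `δ` flips the totals (B5); complete reducibility + the theorem of the
highest weight turn the total gap into a multiplicity gap at some weight (B4), which the bridge (B6: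
left-translation representation, `orbitCoordToPoly`, partition form, degree pinning) makes a crux weight
`λ* = (dualOfPartition (n·n) λ).toMatIdx`, `λ ⊢ nδ`.  Finally `T_⊥ ≤ E` because abstract `Stab_End(det_n)`-invariants
are sandwich- and transpose-invariant (stub 1).

This is the only slice of the crux that is a theorem today; above the bottom (`n < m`) the census flip is the
open multiplicity-obstruction problem of the Mulmuley–Sohoni programme (registered stub
`stub_censusFlipAboveBottom`, see `Cruxes/ValuativeFlip/Lines/skew-restriction-rank.lean`).
-/

set_option linter.dupNamespace false

namespace Summit.ValiantsHypothesis.ValiantsHypothesis.Theorems.ValuativeFlip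

open MvPolynomial
open scoped BigOperators Matrix
open Literature.NumberTheory.DiophantineGeometry
open Literature.Computability.AlgebraicComplexity

noncomputable section

/-- `2n² ≤ n⁴` for `n ≥ 2`. [folklore] -/
theorem bw_two_mul_sq_le_pow_four {n : ℕ} (hn : 2 ≤ n) : 2 * n ^ 2 ≤ n ^ 4 := by
  have h2 : 2 ≤ n ^ 2 := by nlinarith
  calc 2 * n ^ 2 ≤ n ^ 2 * n ^ 2 := Nat.mul_le_mul_right _ h2
    _ = n ^ 4 := by ring

/-- Arithmetic of the exponents: `z + 1 ≤ N` for `z = n⁴ - 2n² + 2n`, `N = n⁴ - n² - 1`, `n ≥ 3`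
(the slice dimension loses to the tangent rank). [folklore] -/
theorem bw_exponent_gap {n : ℕ} (hn : 3 ≤ n) :
    (n ^ 4 - 2 * n ^ 2 + 2 * n) + 1 ≤ n ^ 4 - n ^ 2 - 1 := by
  have h1 : 2 * n + 3 ≤ n ^ 2 := by nlinarith
  have h2 : 2 * n ^ 2 ≤ n ^ 4 := bw_two_mul_sq_le_pow_four (by omega)
  generalize n ^ 4 = A at *
  generalize n ^ 2 = B at *
  omega

/-- **The bottom of every window, E-currency** (`m = n ≥ 3`): there are `δ` and `λ ⊢ nδ` with at most
`n²` parts such that the explicit det-side census space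
`E(λ) = Hom_{nδ}(ℂ[End W]) ∩ (row-wise unimodular sandwich invariants) ∩ (row-wise transpose invariants) ∩ HWV_{λ*}`
has dimension strictly below the multiplicity of `λ*` in `ℂ[Δ_n(per_n)]`
(`orbitMultiplicity ℂ (paddedPerFormLex ℂ n n) n λ*`).  Composition of the landed stubs B1–B6 (module docstring).
[BLMW 2011 §5.2 (symmetric Kronecker space); Mulmuley–Sohoni 2001 §4–5; this line] -/
theorem bottomCensusFlip (n : ℕ) [NeZero n] (hn : 3 ≤ n) :
    ∃ (δ : ℕ) (lam : Nat.Partition (n * δ)), lam.parts.card ≤ n * n ∧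
      Module.finrank ℂ ↥(MvPolynomial.homogeneousSubmodule (MatIdx n × MatIdx n) ℂ (n * δ) ⊓
          ((⨅ (P : Matrix (Fin n) (Fin n) ℂ) (Q : Matrix (Fin n) (Fin n) ℂ) (_ : P.det = 1) (_ : Q.det = 1),
              LinearMap.ker ((MvPolynomial.aeval fun p : MatIdx n × MatIdx n =>
                  ∑ l : MatIdx n, (P (ofLex p.2).1 (ofLex l).1 * Q (ofLex l).2 (ofLex p.2).2) •
                    (MvPolynomial.X (p.1, l) : MvPolynomial (MatIdx n × MatIdx n) ℂ)).toLinearMap -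
                (LinearMap.id : MvPolynomial (MatIdx n × MatIdx n) ℂ →ₗ[ℂ] MvPolynomial (MatIdx n × MatIdx n) ℂ))) ⊓
            LinearMap.ker ((MvPolynomial.aeval fun p : MatIdx n × MatIdx n =>
                (MvPolynomial.X (p.1, toLex ((ofLex p.2).2, (ofLex p.2).1)) :
                  MvPolynomial (MatIdx n × MatIdx n) ℂ)).toLinearMap -
              (LinearMap.id : MvPolynomial (MatIdx n × MatIdx n) ℂ →ₗ[ℂ] MvPolynomial (MatIdx n × MatIdx n) ℂ))) ⊓
          (⨅ (g : Matrix.GeneralLinearGroup (MatIdx n) ℂ) (_ : IsUpperTriangular g),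
              LinearMap.ker ((MvPolynomial.aeval fun p : MatIdx n × MatIdx n =>
                  ∑ l : MatIdx n, ((g⁻¹ : Matrix.GeneralLinearGroup (MatIdx n) ℂ) :
                    Matrix (MatIdx n) (MatIdx n) ℂ) p.1 l •
                      (MvPolynomial.X (l, p.2) : MvPolynomial (MatIdx n × MatIdx n) ℂ)).toLinearMap -
                weightChar ((Weight.dualOfPartition (n * n) lam).toMatIdx : Weight (MatIdx n)) g •
                  (LinearMap.id : MvPolynomial (MatIdx n × MatIdx n) ℂ →ₗ[ℂ] MvPolynomial (MatIdx n × MatIdx n) ℂ)))) <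
        orbitMultiplicity ℂ (paddedPerFormLex ℂ n n) n
          ((Weight.dualOfPartition (n * n) lam).toMatIdx : Weight (MatIdx n)) := by
  obtain ⟨hpp0, htan⟩ := stub_tangentRank n hn
  have hzN := bw_exponent_gap hn
  obtain ⟨δ, hδ⟩ := stub_growthGap n (n ^ 4 - 2 * n ^ 2 + 2 * n) (n ^ 4 - n ^ 2 - 1) hzN
  have hN : (n ^ 4 - n ^ 2 - 1) + 1 ≤ Module.finrank ℂ ↥(Submodule.span ℂ (Set.range
      fun ab : MatIdx n × MatIdx n => MvPolynomial.X ab.1 * MvPolynomial.pderiv ab.2 (paddedPerFormLex ℂ n n))) := by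
    have h9 : 2 * n ^ 2 ≤ n ^ 4 := bw_two_mul_sq_le_pow_four (by omega)
    have h1 : 1 ≤ n ^ 2 := Nat.one_le_pow _ _ (by omega)
    revert htan h9 h1
    generalize n ^ 4 = A
    generalize n ^ 2 = B
    intro htan h9 h1
    omega
  have h3 := stub_hilbertLowerBound (MatIdx n) (paddedPerFormLex ℂ n n) n
    (paddedPerFormLex_isHomogeneous ℂ le_rfl) hpp0 (n ^ 4 - n ^ 2 - 1) δ hN
  have h1 := stub_sliceBound n (by omega) (n * δ)
  -- finiteness of `Hom ⊓ sandInv`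
  have hfin : Module.Finite ℂ ↥(MvPolynomial.homogeneousSubmodule (MatIdx n × MatIdx n) ℂ (n * δ) ⊓
      (⨅ (P : Matrix (Fin n) (Fin n) ℂ) (Q : Matrix (Fin n) (Fin n) ℂ) (_ : P.det = 1) (_ : Q.det = 1),
              LinearMap.ker ((MvPolynomial.aeval fun p : MatIdx n × MatIdx n =>
                  ∑ l : MatIdx n, (P (ofLex p.2).1 (ofLex l).1 * Q (ofLex l).2 (ofLex p.2).2) •
                    (MvPolynomial.X (p.1, l) : MvPolynomial (MatIdx n × MatIdx n) ℂ)).toLinearMap -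
                (LinearMap.id : MvPolynomial (MatIdx n × MatIdx n) ℂ →ₗ[ℂ] MvPolynomial (MatIdx n × MatIdx n) ℂ)))) := by
    have : Module.Finite ℂ ↥(MvPolynomial.homogeneousSubmodule (MatIdx n × MatIdx n) ℂ (n * δ)) :=
      Module.Finite.iff_fg.mpr (MvPolynomial.homogeneousSubmodule_fg (MatIdx n × MatIdx n) ℂ (n * δ))
    exact Submodule.finiteDimensional_of_le inf_le_left
  have hmono : Module.finrank ℂ ↥(MvPolynomial.homogeneousSubmodule (MatIdx n × MatIdx n) ℂ (n * δ) ⊓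
        ((⨅ (P : Matrix (Fin n) (Fin n) ℂ) (Q : Matrix (Fin n) (Fin n) ℂ) (_ : P.det = 1) (_ : Q.det = 1),
              LinearMap.ker ((MvPolynomial.aeval fun p : MatIdx n × MatIdx n =>
                  ∑ l : MatIdx n, (P (ofLex p.2).1 (ofLex l).1 * Q (ofLex l).2 (ofLex p.2).2) •
                    (MvPolynomial.X (p.1, l) : MvPolynomial (MatIdx n × MatIdx n) ℂ)).toLinearMap -
                (LinearMap.id : MvPolynomial (MatIdx n × MatIdx n) ℂ →ₗ[ℂ] MvPolynomial (MatIdx n × MatIdx n) ℂ))) ⊓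
          LinearMap.ker ((MvPolynomial.aeval fun p : MatIdx n × MatIdx n =>
                (MvPolynomial.X (p.1, toLex ((ofLex p.2).2, (ofLex p.2).1)) :
                  MvPolynomial (MatIdx n × MatIdx n) ℂ)).toLinearMap -
              (LinearMap.id : MvPolynomial (MatIdx n × MatIdx n) ℂ →ₗ[ℂ] MvPolynomial (MatIdx n × MatIdx n) ℂ)))) ≤
      Module.finrank ℂ ↥(MvPolynomial.homogeneousSubmodule (MatIdx n × MatIdx n) ℂ (n * δ) ⊓
        (⨅ (P : Matrix (Fin n) (Fin n) ℂ) (Q : Matrix (Fin n) (Fin n) ℂ) (_ : P.det = 1) (_ : Q.det = 1),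
              LinearMap.ker ((MvPolynomial.aeval fun p : MatIdx n × MatIdx n =>
                  ∑ l : MatIdx n, (P (ofLex p.2).1 (ofLex l).1 * Q (ofLex l).2 (ofLex p.2).2) •
                    (MvPolynomial.X (p.1, l) : MvPolynomial (MatIdx n × MatIdx n) ℂ)).toLinearMap -
                (LinearMap.id : MvPolynomial (MatIdx n × MatIdx n) ℂ →ₗ[ℂ] MvPolynomial (MatIdx n × MatIdx n) ℂ)))) :=
    Submodule.finrank_mono (inf_le_inf_left _ inf_le_left)
  have hgap := lt_of_le_of_lt (hmono.trans h1) (lt_of_lt_of_le hδ h3)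
  obtain ⟨lam, hcard, hlt⟩ := stub_bottomBridge stub_multiplicityCount n δ hgap
  exact ⟨δ, lam, hcard, hlt⟩

/-- **`ValuativeFlip` at the bottom of every window.**  For every `n ≥ 3` the body of the crux
`Summit.ValiantsHypothesis.ValiantsHypothesis.Theses.ValuativeGCT.ValuativeFlip` (route file, verbatim, with
`m := n`) holds: there are a centre `U` (here the no-cut centre `U = ⊥`, `r = 0`), a degree `δ` and a shape
`λ ⊢ nδ` (`≤ n²` parts) whose VALUATIVE TRUNCATION `T_U(λ)` has dimension strictly below the multiplicity of
`λ*` in `ℂ[Δ_n(per_n)]`.  From `bottomCensusFlip` and `stub_stabInv_le_explicit` (`T_⊥ ≤ E`: abstract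
`Stab_End(det_n)`-invariants are sandwich- and transpose-invariant).  So any proof of the crux only has to treat
`n < m ≤ 2^((log₂ n + c)^c)`.  [Mulmuley–Sohoni 2001 §4–5; BLMW 2011 §5.2; this line] -/
theorem valuativeFlip_bottom (n : ℕ) [NeZero n] (hn : 3 ≤ n) :
    ∃ (U : Submodule ℂ (MatIdx n → ℂ)) (r δ : ℕ) (lam : Nat.Partition (n * δ)),
      (∀ u ∈ U, (Matrix.of fun a b : Fin n => u (toLex (a, b))).rank ≤ r) ∧ lam.parts.card ≤ n * n ∧
        Module.finrank ℂ ↥(MvPolynomial.homogeneousSubmodule (MatIdx n × MatIdx n) ℂ (n * δ) ⊓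
            ((MvPolynomial.vanishingIdeal ℂ
                {p : MatIdx n × MatIdx n → ℂ | ∀ j : MatIdx n, (fun i => p (j, i)) ∈ U}) ^ (δ * (n - r))).restrictScalars ℂ ⊓
            (⨅ (M : Matrix (MatIdx n) (MatIdx n) ℂ)
              (_ : linSubst (MatIdx n) ℂ M (detFormLex ℂ n) = detFormLex ℂ n),
              LinearMap.ker ((MvPolynomial.aeval fun p : MatIdx n × MatIdx n =>
                  ∑ l : MatIdx n, M l p.2 •
                    (MvPolynomial.X (p.1, l) : MvPolynomial (MatIdx n × MatIdx n) ℂ)).toLinearMap -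
                (LinearMap.id : MvPolynomial (MatIdx n × MatIdx n) ℂ →ₗ[ℂ] MvPolynomial (MatIdx n × MatIdx n) ℂ))) ⊓
            (⨅ (g : Matrix.GeneralLinearGroup (MatIdx n) ℂ) (_ : IsUpperTriangular g),
              LinearMap.ker ((MvPolynomial.aeval fun p : MatIdx n × MatIdx n =>
                  ∑ l : MatIdx n, ((g⁻¹ : Matrix.GeneralLinearGroup (MatIdx n) ℂ) :
                    Matrix (MatIdx n) (MatIdx n) ℂ) p.1 l •
                      (MvPolynomial.X (l, p.2) : MvPolynomial (MatIdx n × MatIdx n) ℂ)).toLinearMap -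
                weightChar ((Weight.dualOfPartition (n * n) lam).toMatIdx : Weight (MatIdx n)) g •
                  (LinearMap.id : MvPolynomial (MatIdx n × MatIdx n) ℂ →ₗ[ℂ] MvPolynomial (MatIdx n × MatIdx n) ℂ)))) <
          orbitMultiplicity ℂ (paddedPerFormLex ℂ n n) n
            ((Weight.dualOfPartition (n * n) lam).toMatIdx : Weight (MatIdx n)) := by
  obtain ⟨δ, lam, hcard, hlt⟩ := bottomCensusFlip n hn
  refine ⟨⊥, 0, δ, lam, ?_, hcard, ?_⟩
  · intro u hu
    rw [Submodule.mem_bot] at hu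
    subst hu
    have h0 : (Matrix.of fun a b : Fin n => (0 : MatIdx n → ℂ) (toLex (a, b))) = 0 := by
      ext a b
      simp
    rw [h0, Matrix.rank_zero]
  · haveI : Module.Finite ℂ ↥(MvPolynomial.homogeneousSubmodule (MatIdx n × MatIdx n) ℂ (n * δ)) :=
      Module.Finite.iff_fg.mpr (MvPolynomial.homogeneousSubmodule_fg (MatIdx n × MatIdx n) ℂ (n * δ))
    exact lt_of_le_of_lt (Submodule.finrank_mono (inf_le_inf (le_inf (inf_le_left.trans inf_le_left)
      (inf_le_right.trans (stub_stabInv_le_explicit n))) le_rfl)) hlt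

/-- The same, typed LITERALLY as the body of the route decl `ValuativeGCT.ValuativeFlip` at `m := n` (its `let χ`,
`let T` and named-argument spelling); definitionally equal to `valuativeFlip_bottom`.  [this line] -/
theorem valuativeFlip_cruxBody_bottom (n : ℕ) [NeZero n] (hn : 3 ≤ n) :
    ∃ (U : Submodule ℂ (Literature.NumberTheory.DiophantineGeometry.MatIdx n → ℂ)) (r δ : ℕ) (lam : Nat.Partition (n * δ)), (∀ u ∈ U, (Matrix.of fun a b : Fin n => u (toLex (a, b))).rank ≤ r) ∧ lam.parts.card ≤ n * n ∧ (let χ : Literature.NumberTheory.DiophantineGeometry.Weight (Literature.NumberTheory.DiophantineGeometry.MatIdx n) := (Literature.NumberTheory.DiophantineGeometry.Weight.dualOfPartition (n * n) lam).toMatIdx; let T : Submodule ℂ (MvPolynomial (Literature.NumberTheory.DiophantineGeometry.MatIdx n × Literature.NumberTheory.DiophantineGeometry.MatIdx n) ℂ) := MvPolynomial.homogeneousSubmodule (Literature.NumberTheory.DiophantineGeometry.MatIdx n × Literature.NumberTheory.DiophantineGeometry.MatIdx n) ℂ (n * δ) ⊓ ((MvPolynomial.vanishingIdeal ℂ {p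 : Literature.NumberTheory.DiophantineGeometry.MatIdx n × Literature.NumberTheory.DiophantineGeometry.MatIdx n → ℂ | ∀ j : Literature.NumberTheory.DiophantineGeometry.MatIdx n, (fun i => p (j, i)) ∈ U}) ^ (δ * (n - r))).restrictScalars ℂ ⊓ (⨅ (M : Matrix (Literature.NumberTheory.DiophantineGeometry.MatIdx n) (Literature.NumberTheory.DiophantineGeometry.MatIdx n) ℂ) (_ : Literature.Computability.AlgebraicComplexity.linSubst (Literature.NumberTheory.DiophantineGeometry.MatIdx n) ℂ M (Literature.NumberTheory.DiophantineGeometry.detFormLex ℂ n) = Literature.NumberTheory.DiophantineGeometry.detFormLex ℂ n), LinearMap.ker ((MvPolynomial.aeval (R := ℂ) fun p : Literature.NumberTheory.DiophantineGeometry.MatIdx n × Literature.NumberTheory.DiophantineGeometry.MatIdx n => ∑ l : Literature.NumberTheory.DiophantineGeometry.MatIdx n, M l p.2 • MvPolynomial.X (p.1, l)).toLinearMap - LinearMap.id (R := ℂ) (M := MvPolynomial (Literature.NumberTheory.DiophantineGeometry.MatIdx n × Literature.NumberTheory.DiophantineGeometry.MatIdx n) ℂ))) ⊓ (⨅ (g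 : Matrix.GeneralLinearGroup (Literature.NumberTheory.DiophantineGeometry.MatIdx n) ℂ) (_ : Literature.NumberTheory.DiophantineGeometry.IsUpperTriangular g), LinearMap.ker ((MvPolynomial.aeval (R := ℂ) fun p : Literature.NumberTheory.DiophantineGeometry.MatIdx n × Literature.NumberTheory.DiophantineGeometry.MatIdx n => ∑ l : Literature.NumberTheory.DiophantineGeometry.MatIdx n, ((g⁻¹ : Matrix.GeneralLinearGroup (Literature.NumberTheory.DiophantineGeometry.MatIdx n) ℂ) : Matrix (Literature.NumberTheory.DiophantineGeometry.MatIdx n) (Literature.NumberTheory.DiophantineGeometry.MatIdx n) ℂ) p.1 l • MvPolynomial.X (l, p.2)).toLinearMap - Literature.NumberTheory.DiophantineGeometry.weightChar χ g • LinearMap.id (R := ℂ) (M := MvPolynomial (Literature.NumberTheory.DiophantineGeometry.MatIdx n × Literature.NumberTheory.DiophantineGeometry.MatIdx n) ℂ))); Module.finrank ℂ ↥T < Literature.NumberTheory.DiophantineGeometry.orbitMultiplicity ℂ (Literature.NumberTheory.DiophantineGeometry.paddedPerFormLex ℂ n n) n χ) :=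
  valuativeFlip_bottom n hn

end

end Summit.ValiantsHypothesis.ValiantsHypothesis.Theorems.ValuativeFlip
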